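import Literature.NumberTheory.LFunctions.ChebyshevPsiExplicitPartialRH
import Literature.NumberTheory.LFunctions.ChebyshevSylvesterPrimeWindows
import HarnessLib

/-!
# Prime windows of PNT quality: Ford's Lemma 2.1 (second part) unconditionally

Topic `Literature/NumberTheory/LFunctions`. Everything here is PROVED (no named facts; computational
through `ChebyshevPsiExplicitPartialRH.lean`).

K. Ford, Proc. LMS 85 (2002), Lemma 2.1, second part: "if `0 < δ ≤ 1/2`, `N/log N ≥ 6/δ`,
`x ≥ e^{1.5+1.5/δ}` and `x ≥ (6/δ)N log N`, then there are at least `N` primes in `(x, x+δx]`", used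
in Lemma 3.4 (`𝒫_i` = the `k³` smallest primes `> M_i` lie in `(M_i, (1+ω)M_i]` for
`M_i ≥ V = max(e^{1.5+1.5/ω}, (18/ω)k³ log k)`) and in Lemma 6.5. Ford derives it from the
Rosser–Schoenfeld bounds (2.1) for `π(x)`, which the tree does not have; the tree's windows are of
Chebyshev–Sylvester quality (`ChebyshevSylvesterPrimeWindows.lean`, ratio `23/20`) or `(x, 4x]`
(`FordPrimeWindows.lean`). Here the unconditional explicit bounds
`ψ(x) ≤ 1.0092x`, `θ(y) ≥ 0.988y` (`x, y ≥ 10⁸`) from `ChebyshevPsiExplicitPartialRH.lean` give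
windows of every fixed ratio `1 + ω`, `ω ≥ 1/20`:

* `abs_theta_sub_self_le` — `|θ(x) − x| ≤ 0.012x` (`x ≥ 10⁸`);
* `theta_window_ge` — `θ((1+ω)x) − θ(x) ≥ (0.988ω − 0.0212)x` (`ω ≥ 1/20`, `x ≥ 10⁸`);
* `card_primes_window_ge` — at least `0.56ω·x/log((1+ω)x)` primes in `(x, (1+ω)x]`;
* `exists_primes_window_card` — **for `N ≥ 2²¹`, `1/20 ≤ ω ≤ 1`, `x ≥ (6/ω)N log N`, the interval
  `(x, (1+ω)x]` contains a set of exactly `N` primes** (Ford's Lemma 2.1, second part; the hypothesis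
  `x ≥ e^{1.5+1.5/δ}` is not needed);
* `exists_primes_window` — the `k³` form (`k ≥ 128`, `x ≥ (18/ω)k³ log k`) in the shape of the
  hypothesis `hprime` of `FordVK.ford_lemma65'`, and `exists_primes_window_V` with Ford's threshold `V`.

The range `ω ≥ 1/20` covers Ford's uses in §3 (`ω ∈ [1/(3 log k), 1/2]` with
`e^{1.5+1.5/ω} = (18/ω)k³ log k` for `129 ≤ k ≤ 1001`, where `ω ≥ 0.055`; `ω = 0.06` for
`k ≥ 1000`, Lemma 3.6).

## References

* K. Ford, *Vinogradov's integral and bounds for the Riemann zeta function*, Proc. London Math.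
  Soc. (3) 85 (2002), 565–633; arXiv:1910.08209: Lemma 2.1 and the proofs of Lemmas 3.4, 3.6.
  [Ford2002]
* J. B. Rosser, L. Schoenfeld, Math. Comp. 29 (1975), 243–269, Lemma 8. [RosserSchoenfeld1975]
-/

noncomputable section

open Real Set
open scoped Chebyshev

namespace Literature.NumberTheory.LFunctions

namespace PrimeWindowsPNT

open PsiFromZeros2516

/-- `ψ(x) ≤ 1.0092·x` for `x ≥ 10⁸` (`5.72√x ≤ 0.000572 x`). [cite: RosserSchoenfeld1975, Lemma 8 (the differencing method; constants here weaker than the printed theorems)] -/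
theorem psi_le_of_ge {x : ℝ} (hx : 100000000 ≤ x) : ψ x ≤ 1.0092 * x := by
  have h := psi_sub_self_le (show (9 : ℝ) ≤ x by linarith)
  have hs : Real.sqrt x ≤ x / 10000 := by
    rw [le_div_iff₀ (by norm_num)]
    have h1 : (10000 : ℝ) ≤ Real.sqrt x := by
      rw [show (10000 : ℝ) = Real.sqrt (10000 ^ 2) by rw [Real.sqrt_sq (by norm_num)]]
      exact Real.sqrt_le_sqrt (by linarith)
    nlinarith [Real.sq_sqrt (show (0 : ℝ) ≤ x by linarith), Real.sqrt_nonneg x]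
  linarith

/-- `θ(y) ≥ 0.988·y` for `y ≥ 10⁸` (`ψ − θ ≤ ψ(√y) + ψ(∛y) + ψ(y^{1/5}) ≤ 3ψ(√y) ≤ 24.22√y` by the
Chebyshev–Sylvester bound, and `ψ(y) ≥ y − 0.0085y − 5.681√y − 1.838`).
[cite: RosserSchoenfeld1975, Lemma 8 (the differencing method; constants here weaker than the printed theorems)] -/
theorem theta_ge_of_ge {y : ℝ} (hy : 100000000 ≤ y) : 0.988 * y ≤ θ y := by
  have hy0 : 0 < y := by linarith
  have hy1 : 1 ≤ y := by linarith
  have h1 := neg_le_psi_sub_self (show (2 : ℝ) ≤ y by linarith)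
  have h2 := Chebyshev.psi_sub_theta_le_psi_add_psi_add_psi y
  -- `y^{1/3}, y^{1/5} ≤ y^{1/2} = √y`
  have hr : ∀ r : ℝ, 2 ≤ r → y ^ r⁻¹ ≤ Real.sqrt y := by
    intro r hr
    rw [Real.sqrt_eq_rpow]
    exact Real.rpow_le_rpow_of_exponent_le hy1 (by rw [inv_le_comm₀ (by linarith) (by norm_num)]; norm_num; linarith)
  have hmono : ∀ r : ℝ, 2 ≤ r → ψ (y ^ r⁻¹) ≤ ψ (Real.sqrt y) := fun r hr2 ↦ Chebyshev.psi_mono (hr r hr2)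
  have h3 : ψ (Real.sqrt y) ≤ 1.0722 * Real.sqrt y + 7 * Real.sqrt (Real.sqrt y) :=
    psi_le_sylvester (Real.sqrt_nonneg y)
  have hs1 : 1 ≤ Real.sqrt y := by rw [show (1 : ℝ) = Real.sqrt 1 by simp]; exact Real.sqrt_le_sqrt hy1
  have h4 : Real.sqrt (Real.sqrt y) ≤ Real.sqrt y := by
    have := Real.sqrt_le_sqrt (show Real.sqrt y ≤ Real.sqrt y * Real.sqrt y by nlinarith)
    rwa [Real.sqrt_mul_self (Real.sqrt_nonneg y)] at this
  have hhalf : y ^ (2 : ℝ)⁻¹ = Real.sqrt y := by rw [Real.sqrt_eq_rpow]; norm_num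
  rw [hhalf] at h2
  have h5 := hmono 3 (by norm_num)
  have h6 := hmono 5 (by norm_num)
  -- `√y ≤ y/10000`
  have hs : Real.sqrt y ≤ y / 10000 := by
    rw [le_div_iff₀ (by norm_num)]
    have h1 : (10000 : ℝ) ≤ Real.sqrt y := by
      rw [show (10000 : ℝ) = Real.sqrt (10000 ^ 2) by rw [Real.sqrt_sq (by norm_num)]]
      exact Real.sqrt_le_sqrt (by linarith)
    nlinarith [Real.sq_sqrt hy0.le, Real.sqrt_nonneg y]
  nlinarith [Real.sqrt_nonneg (Real.sqrt y), Real.sqrt_nonneg y]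

/-- **`|θ(x) − x| ≤ 0.012·x` for `x ≥ 10⁸`** (unconditional, explicit; from `θ ≤ ψ ≤ 1.0092x` and
`θ ≥ 0.988x`). [cite: RosserSchoenfeld1975, Lemma 8 (the differencing method; constants here weaker than the printed theorems)] -/
theorem abs_theta_sub_self_le {x : ℝ} (hx : 100000000 ≤ x) : |θ x - x| ≤ 0.012 * x := by
  have h1 := theta_ge_of_ge hx
  have h2 := psi_le_of_ge hx
  have h3 := Chebyshev.theta_le_psi x
  rw [abs_le]; constructor <;> linarith

/-- **The `θ`-mass of a window of PNT quality**: for `ω ≥ 1/20` and `x ≥ 10⁸`,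
`θ((1+ω)x) − θ(x) ≥ (0.988ω − 0.0212)·x ≥ 0.56ω·x`. [cite: Ford2002, Lemma 2.1 (proof)] -/
theorem theta_window_ge {ω x : ℝ} (hω1 : 1 / 20 ≤ ω) (hx : 100000000 ≤ x) :
    (0.988 * ω - 0.0212) * x ≤ θ ((1 + ω) * x) - θ x := by
  have h1 := theta_ge_of_ge (y := (1 + ω) * x) (by nlinarith)
  have h2 := psi_le_of_ge hx
  have h3 := Chebyshev.theta_le_psi x
  nlinarith

/-- **Counting form**: for `ω ≥ 1/20` and `x ≥ 10⁸`, the interval `(x, (1+ω)x]` contains at least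
`0.56ω·x/log((1+ω)x)` primes. [cite: Ford2002, Lemma 2.1 (second part; PNT-quality substitute)] -/
theorem card_primes_window_ge {ω x : ℝ} (hω1 : 1 / 20 ≤ ω) (hx : 100000000 ≤ x) :
    0.56 * ω * x / Real.log ((1 + ω) * x) ≤
      ((((Finset.Ioc ⌊x⌋₊ ⌊(1 + ω) * x⌋₊).filter Nat.Prime).card : ℕ) : ℝ) := by
  have h1 := theta_window_ge hω1 hx
  have h2 := Sylvester.theta_sub_theta_le_card_mul_log (a := x) (b := (1 + ω) * x) (by linarith) (by nlinarith)
  have hlog : 0 < Real.log ((1 + ω) * x) := Real.log_pos (by nlinarith)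
  rw [div_le_iff₀ hlog]
  have hx0 : 0 < x := by linarith
  nlinarith

/-- Auxiliary step (elementary consequence of the definitions and the standing hypotheses). [folklore] -/
theorem log_ge_of_ge_two_pow_21 {N : ℝ} (hN : 2097152 ≤ N) : 14.55 ≤ Real.log N := by
  have h2 := Real.log_two_gt_d9
  have h21 : Real.log 2097152 = 21 * Real.log 2 := by
    rw [show (2097152 : ℝ) = 2 ^ 21 by norm_num, Real.log_pow]; push_cast; ring
  have := Real.log_le_log (by norm_num) hN
  linarith

/-- Auxiliary step (elementary consequence of the definitions and the standing hypotheses). [folklore] -/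
theorem log_le_two_mul_sqrt {y : ℝ} (hy : 0 ≤ y) : Real.log y ≤ 2 * Real.sqrt y := by
  have h := Real.log_le_rpow_div hy (by norm_num : (0 : ℝ) < 1 / 2)
  rw [← Real.sqrt_eq_rpow] at h
  linarith

/-- **Ford's Lemma 2.1 (second part), with windows of PNT quality**: for `N ≥ 2²¹`, `1/20 ≤ ω ≤ 1`
and every `x ≥ (6/ω) N log N`, the interval `(x, (1+ω)x]` contains a set of exactly `N` primes.
(Ford: "if `0 < δ ≤ 1/2`, `N/log N ≥ 6/δ`, `x ≥ e^{1.5+1.5/δ}` and `x ≥ (6/δ)N log N`, then there are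
at least `N` primes in `(x, x+δx]`"; Ford's proof rests on the Rosser–Schoenfeld bounds (2.1), replaced
here by the tree's unconditional `|ψ(x) − x| ≤ 0.00862x + 5.72√x + 1.838` from the `2000` certified
zeros of `ζ` below height `2516`; the hypothesis `x ≥ e^{1.5+1.5/δ}` is not needed, the ranges are
`δ ∈ [1/20, 1]`, `N ≥ 2²¹`.) Cases: `x ≤ N³`, where `log((1+ω)x) ≤ log 2 + 3 log N`, and `x > N³`,
where `log((1+ω)x) ≤ 2.83√x` and `√x > N^{3/2} ≥ 1448 N`. [cite: Ford2002, Lemma 2.1 (second part)] -/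
theorem exists_primes_window_card {N : ℕ} (hN : 2097152 ≤ N) {ω : ℝ} (hω1 : 1 / 20 ≤ ω) (hω2 : ω ≤ 1)
    {x : ℝ} (hx : 6 / ω * (N : ℝ) * Real.log N ≤ x) :
    ∃ Ps : Finset ℕ, Ps.card = N ∧ ∀ p ∈ Ps, p.Prime ∧ x < p ∧ (p : ℝ) ≤ (1 + ω) * x := by
  have hNr : (2097152 : ℝ) ≤ N := by exact_mod_cast hN
  have hlogN := log_ge_of_ge_two_pow_21 hNr
  have hω0 : 0 < ω := by linarith
  -- `x ≥ 6 N log N ≥ 10⁸`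
  have h6 : 6 * (N : ℝ) * Real.log N ≤ x := by
    have : 6 * (N : ℝ) * Real.log N ≤ 6 / ω * (N : ℝ) * Real.log N := by
      have h1 : (6 : ℝ) ≤ 6 / ω := by rw [le_div_iff₀ hω0]; nlinarith
      have h0 : 0 ≤ (N : ℝ) * Real.log N := by positivity
      nlinarith
    linarith
  have hx8 : (100000000 : ℝ) ≤ x := by nlinarith
  have hx0 : 0 < x := by linarith
  have hcard := card_primes_window_ge hω1 hx8
  have hlog : 0 < Real.log ((1 + ω) * x) := Real.log_pos (by nlinarith)
  have hNle : (N : ℝ) ≤ 0.56 * ω * x / Real.log ((1 + ω) * x) := by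
    rw [le_div_iff₀ hlog]
    have hωx : 6 * (N : ℝ) * Real.log N ≤ ω * x := by
      have := mul_le_mul_of_nonneg_left hx hω0.le
      have e : ω * (6 / ω * (N : ℝ) * Real.log N) = 6 * (N : ℝ) * Real.log N := by field_simp
      linarith
    rcases le_or_gt x ((N : ℝ) ^ 3) with hcase | hcase
    · -- `x ≤ N³`
      have hl : Real.log ((1 + ω) * x) ≤ Real.log 2 + 3 * Real.log N := by
        have h1 : (1 + ω) * x ≤ 2 * (N : ℝ) ^ 3 := by nlinarith
        calc Real.log ((1 + ω) * x) ≤ Real.log (2 * (N : ℝ) ^ 3) := Real.log_le_log (by nlinarith) h1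
          _ = Real.log 2 + 3 * Real.log N := by
              rw [Real.log_mul (by norm_num) (by positivity), Real.log_pow]; push_cast; ring
      have hl2 := Real.log_two_lt_d9
      have hN0 : (0 : ℝ) ≤ N := by positivity
      nlinarith [mul_le_mul_of_nonneg_left hl hN0]
    · -- `x > N³`
      have hl : Real.log ((1 + ω) * x) ≤ 2.83 * Real.sqrt x := by
        have h1 : Real.log ((1 + ω) * x) ≤ Real.log (2 * x) := Real.log_le_log (by nlinarith) (by nlinarith)
        have h2 := log_le_two_mul_sqrt (show (0 : ℝ) ≤ 2 * x by linarith)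
        have h3 : Real.sqrt (2 * x) ≤ 1.415 * Real.sqrt x := by
          rw [Real.sqrt_mul (by norm_num)]
          refine mul_le_mul_of_nonneg_right ?_ (Real.sqrt_nonneg x)
          rw [Real.sqrt_le_left (by norm_num)]; norm_num
        linarith
      have hsx : (N : ℝ) * Real.sqrt N ≤ Real.sqrt x := by
        have e : Real.sqrt ((N : ℝ) ^ 3) = (N : ℝ) * Real.sqrt N := by
          rw [show (N : ℝ) ^ 3 = (N : ℝ) ^ 2 * N by ring, Real.sqrt_mul (by positivity), Real.sqrt_sq (by positivity)]
        rw [← e]; exact Real.sqrt_le_sqrt hcase.le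
      have hsN : (1448 : ℝ) ≤ Real.sqrt N := by
        rw [show (1448 : ℝ) = Real.sqrt (1448 ^ 2) by rw [Real.sqrt_sq (by norm_num)]]
        exact Real.sqrt_le_sqrt (by linarith)
      have hsq := Real.sq_sqrt hx0.le
      have hs0 := Real.sqrt_nonneg x
      have hkey : (N : ℝ) * 2.83 ≤ 0.56 * ω * Real.sqrt x := by
        have : (N : ℝ) * 1448 ≤ Real.sqrt x := by nlinarith
        nlinarith
      calc (N : ℝ) * Real.log ((1 + ω) * x) ≤ (N : ℝ) * (2.83 * Real.sqrt x) :=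
            mul_le_mul_of_nonneg_left hl (by positivity)
        _ = ((N : ℝ) * 2.83) * Real.sqrt x := by ring
        _ ≤ (0.56 * ω * Real.sqrt x) * Real.sqrt x := mul_le_mul_of_nonneg_right hkey hs0
        _ = 0.56 * ω * x := by rw [mul_assoc, ← sq, hsq]
  have hN' : N ≤ ((Finset.Ioc ⌊x⌋₊ ⌊(1 + ω) * x⌋₊).filter Nat.Prime).card := by
    have := hNle.trans hcard
    exact_mod_cast this
  obtain ⟨Ps, hsub, hPs⟩ := Finset.exists_subset_card_eq hN'
  refine ⟨Ps, hPs, fun p hp ↦ ?_⟩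
  have hp' := hsub hp
  rw [Finset.mem_filter, Finset.mem_Ioc] at hp'
  refine ⟨hp'.2, (Nat.floor_lt hx0.le).1 hp'.1.1, ?_⟩
  exact (Nat.le_floor_iff (by positivity)).1 hp'.1.2

/-- **The `k³` form used in Ford's Lemma 3.4** (`𝒫_i` = `k³` primes in `(M_i, (1+ω)M_i]` once
`M_i ≥ (18/ω)k³ log k`): for `k ≥ 128`, `1/20 ≤ ω ≤ 1`, `x ≥ (18/ω) k³ log k`, the interval
`(x, (1+ω)x]` contains a set of exactly `k³` primes — the shape of the prime-window hypothesis of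
`FordVK.ford_lemma65'` / `FordRowChain` with `η = 1 + ω`.
[cite: Ford2002, Lemma 2.1 and proof of Lemma 3.4] -/
theorem exists_primes_window {k : ℕ} (hk : 128 ≤ k) {ω : ℝ} (hω1 : 1 / 20 ≤ ω) (hω2 : ω ≤ 1)
    {x : ℝ} (hx : 18 / ω * (k : ℝ) ^ 3 * Real.log k ≤ x) :
    ∃ Ps : Finset ℕ, Ps.card = k ^ 3 ∧ ∀ p ∈ Ps, p.Prime ∧ x < p ∧ (p : ℝ) ≤ (1 + ω) * x := by
  have hk3 : 2097152 ≤ k ^ 3 := by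
    calc 2097152 = 128 ^ 3 := by norm_num
      _ ≤ k ^ 3 := Nat.pow_le_pow_left hk 3
  refine exists_primes_window_card hk3 hω1 hω2 ?_
  have e : 6 / ω * ((k ^ 3 : ℕ) : ℝ) * Real.log ((k ^ 3 : ℕ) : ℝ) = 18 / ω * (k : ℝ) ^ 3 * Real.log k := by
    push_cast
    rw [Real.log_pow]; push_cast; ring
  rw [e]; exact hx

/-- The same with Ford's threshold `V = max(e^{1.5+1.5/ω}, (18/ω)k³ log k)` of Lemma 3.4.
[cite: Ford2002, Lemma 2.1 and Lemma 3.4 ("`𝒫_i ⊂ (M_i, ηM_i]`")] -/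
theorem exists_primes_window_V {k : ℕ} (hk : 128 ≤ k) {ω : ℝ} (hω1 : 1 / 20 ≤ ω) (hω2 : ω ≤ 1) :
    ∀ x : ℝ, max (Real.exp (1.5 + 1.5 / ω)) (18 / ω * (k : ℝ) ^ 3 * Real.log k) ≤ x →
      ∃ Ps : Finset ℕ, Ps.card = k ^ 3 ∧ ∀ p ∈ Ps, p.Prime ∧ x < p ∧ (p : ℝ) ≤ (1 + ω) * x :=
  fun _ hx ↦ exists_primes_window hk hω1 hω2 ((le_max_right _ _).trans hx)

end PrimeWindowsPNT
end Literature.NumberTheory.LFunctions
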